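import Summits.KontsevichZagierPeriods.Zeta5Search.Barrier.ConeGammaDelta28Sum

/-!
# ζ(5) search — BARRIER: two corollaries for integer parameter vectors (census normalisation; the exponent)

HONEST FRAMING (cell `pub-zeta5`): systematic search; no irrationality claim unless kernel-certified. MODEL objects
under Brown–Zudilin's (28)+(30) accounting ([BZ22] = arXiv:2210.03391); nothing here is a statement about `ζ(5)`
beyond the CONDITIONAL exponent statement of `ConeGammaAccounting.exponent_of_accounting`, whose hypothesis
`DenominatorRate` is now discharged; records in print UNMOVED (every `γ` the cell has computed is `< 1`). Theory
seat cert-2 g17 (WAKE w3 of lead/lit g23).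

* `exists_phi30_realDir_eq_digammaSum` — the census normalisation BY NAME: for an integer parameter vector of the
  closed box (period `T = 1`), `Φ(a) = Σ_{1≤m<M} c_m·(ψ(b_{m+1}) − ψ(b_m))` for the breakpoints `0 = b₀ < ⋯ <
  b_M = 1` and gap values `c_m` of `u ↦ N_a(u)` on `[0,1)` — the census kernel's `∫₀¹ N_a ψ′` summed by parts.
* **`exponent_of_accounting_of_BZBox`** — for integer `a` in the closed box, BZ's worthiness exponent statement
  `|ζ(5) − p_n/q_n| < q_n^{−(γ(a) − ε)}` (eventually, for the explicit real sequences `p_n = Φ_n⁻¹D_nP_n`,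
  `q_n = Φ_n⁻¹D_nQ(a·n)`) needs ONLY `RatesIdentified a P` (BZ §5 recipe, Poincaré–Perron; NOT proved) and the
  positivity of the denominator exponent: the `DenominatorRate` hypothesis is a theorem (`denominatorRate_of_BZBox`).
  Integrality of `p_n, q_n` (the rungs `Law28`/`Law30`) is what an irrationality MEASURE would need on top; it is
  not used by this inequality and remains a named hypothesis elsewhere.
-/

noncomputable section

open Set Filter
open scoped Topology

namespace Summit.KontsevichZagierPeriods.Zeta5Search.Barrier.ConeGamma

open Literature.NumberTheory.Irrationality.BrownZudilin2022 (hForm)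
open Literature.NumberTheory.Transcendental (zetaValue)

/-- **Census normalisation by name**: for an integer parameter vector of the closed box there are breakpoints
`0 = b₀ < b₁ < ⋯ < b_M = 1` and gap values `c_m` (`N_a ≡ c_m` on `[b_m, b_{m+1})`) with
`Φ(a) = Σ_{1≤m<M} c_m·(ψ(b_{m+1}) − ψ(b_m))` (`ψ = Complex.digamma`, real part). -/
theorem exists_phi30_realDir_eq_digammaSum {a : Fin 8 → ℤ} (ha : BZBox (realDir a)) :
    ∃ (M : ℕ) (b : ℕ → ℝ) (c : ℕ → ℤ), b 0 = 0 ∧ b M = 1 ∧ (∀ m < M, b m < b (m + 1)) ∧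
      (∀ m < M, ∀ u ∈ Set.Ico (b m) (b (m + 1)), savingN (realDir a) u = c m) ∧
      phi30 (realDir a) = ∑ m ∈ Finset.Ico 1 M, (c m : ℝ) *
        (Complex.digamma ((b (m + 1) : ℝ) : ℂ) - Complex.digamma ((b m : ℝ) : ℂ)).re := by
  have hper : ∀ k : Fin 28, ∃ z : ℤ, (1 : ℝ) * h28 (realDir a) k = z :=
    fun k => ⟨hForm a (k + 1), by rw [one_mul, h28_realDir]⟩
  obtain ⟨M, b, c, hb0, hbM, hb, hc, hΦ⟩ := exists_phi30_eq_digammaSum ha one_pos hper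
  refine ⟨M, b, c, hb0, hbM, hb, hc, ?_⟩
  rw [hΦ, div_one]
  simp only [div_one]

/-- **The exponent statement on the closed box, with `DenominatorRate` discharged**: for an integer parameter
vector `a` of the closed box, `RatesIdentified a P` and `0 < C₁ + δ₂₈ − Φ` already give BZ's conclusion
`|ζ(5) − p_n/q_n| < q_n^{−(γ(a) − ε)}` eventually (reals `p_n = Φ_n⁻¹D_nP_n`, `q_n = Φ_n⁻¹D_nQ(a·n)`; their
integrality = `Law30` is not needed here and not claimed). MODEL statement; every computed `γ < 1`. -/
theorem exponent_of_accounting_of_BZBox {a : Fin 8 → ℤ} {P : ℕ → ℚ} (ha : BZBox (realDir a))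
    (hR : RatesIdentified a P) (hpos : 0 < C1 (realDir a) + delta28 (realDir a) - phi30 (realDir a))
    {ε : ℝ} (hε : 0 < ε) :
    ∀ᶠ n : ℕ in atTop,
      |zetaValue 5 - approxP a P n / approxQ a n| < 1 / |approxQ a n| ^ (gamma (realDir a) - ε) :=
  exponent_of_accounting hR (denominatorRate_of_BZBox ha) hpos hε

end Summit.KontsevichZagierPeriods.Zeta5Search.Barrier.ConeGamma

end
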